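import Summits.QuantumFields.YangMills.Theorems.FlatTubeReductionReferenceTail
import HarnessLib

/-!
# ASSEMBLED: moments of the reference density against ANY weight of polynomial growth in the kinetic level — `∫ρ₁·M dμP ≤ κ(M)·∫ρ₁ dμP`,
# `κ(M) = 5e·2^k·4^{3n}·k!·(3n)!·D·V / (c₁·fpZ ε·(ρ³/10)^n·θ²)` for `0 ≤ M ≤ D(β·kinDefect + 1)^k` (profile moments only, no logarithm)
# (route `FlatTubeReduction`, crux K1 `NearFlatRatioLaw` stmt-QuantumFields-24720; seat `ym-line-ftr-p1` g12; rate twin «ratepack-v3 / frozen fibres»; R2b1 RECORD rung — no summit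
# statement is proved here)

WHY (memo `Cruxes/NearFlatRatioLaw/Lines/ratepack-v3-frozen-g12.md` §5.9 (e)).  The core moments `m₂ = ∫_Sρ₁M₂/∫ρ₁`, `m_R = ∫_Sρ₁M_R/∫ρ₁` of
`…DiagonalMomentSandwichCore.fpBOKernel_diag_two_sided_moment_core` follow from this theorem with `M = 𝟙_S·M₂` (resp. `𝟙_S·M_R`) once the pointwise bounds of
`…DiagonalMomentPointwise` are expressed as `≤ D(N+1)^k` on the core (`D ≍ δ₁² + β^{-1/2}` — the successor's numerology).  Same data as `…ReferenceTail.reference_tail_le`;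
the engine is `…GaussianLayerCakeWeighted.moment_ratio_le_weighted`.
  ★★★ `reference_moment_le`.
HONEST FRAMING: assembly bookkeeping; femto rung R2b1 (RECORD label); not infinite volume, not a gap, not Clay.  No defs, no named facts, no `sorry`.
-/

set_option autoImplicit false

noncomputable section

open MeasureTheory Filter Topology Real Set
open scoped BigOperators ENNReal
open Literature.MathematicalPhysics.QuantumFieldTheory
open Literature.MathematicalPhysics.QuantumLattice

namespace Summit.QuantumFields.YangMills.Theorems.FemtoTransferGap.RateTube

open Summit.QuantumFields.YangMills.Theorems.FemtoTransferGap
open Summit.QuantumFields.YangMills.Theorems.FemtoTransferGap.TwoLattice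
open Summit.QuantumFields.YangMills.Theorems.FemtoTransferGap.TwoLattice.ConstTube
open Summit.QuantumFields.YangMills.Theorems.FemtoTransferGap.TwoLattice.Avg
open Summit.QuantumFields.YangMills.Theorems.FemtoTransferGap.TwoLattice.Cov
open Summit.QuantumFields.YangMills.Theorems.FemtoTransferGap.TwoLattice.Stiff (LinkSpace)

variable {L : ℕ} [NeZero L]

set_option maxHeartbeats 800000 in
/-- ★★★ **THE REFERENCE MOMENTS, ASSEMBLED.**  `β > 0`; a profile `Ω` (measurable, `0 ≤ Ω ≤ CΩ`, supported in the capped balanced set with `‖v̂‖ ≤ R`); a fibre core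
`C ⊆ {v ∈ capBalancedSet, ‖v̂‖ ≤ r₀, |v_{e,c}| ≤ t₀}` (measurable, `t₀ ≤ 1/30`) with profile mass `θ = ∫_C Ω dπ > 0`; `0 < ε`; `0 < ρ ≤ 1`; `n = |Λ| − 1`.  Then for every measurable
weight `0 ≤ M ≤ D·(β·kinDefect + 1)^k` (`D ≥ 0`): `∫ ρ₁·M dμP ≤ κ·∫ ρ₁ dμP` with `ρ₁ = fpTriple β Ω (fpWeight ε) 1 1` and the explicit, β-bookkept
`κ = 5e·2^k·4^{3n}·k!·(3n)!·D·V / (c₁·fpZ ε·(ρ³/10)^n·θ²)`, `V` the constant of `profile_volume_growth`, `c₁ = exp(−β|E|(2ρ + 2√2r₀)² − (β/2)(2(10√N_P r₀)² + 2E(t₀,0)))`.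
[cite: Luscher1983, §3] -/
theorem reference_moment_le {β : ℝ} (hβ : 0 < β) {Ω : LinkSpace L → ℝ} (hΩm : Measurable Ω) {CΩ : ℝ} (hCΩ : ∀ x, |Ω x| ≤ CΩ) (hΩ0 : ∀ x, 0 ≤ Ω x) {R : ℝ}
    (hΩt : ∀ v : Edge 3 L → Fin 3 → ℝ, Ω (linkEmbed L v) ≠ 0 → v ∈ capBalancedSet L ∧ ‖linkEmbed L v‖ ≤ R)
    {C : Set (Edge 3 L → Fin 3 → ℝ)} (hC : MeasurableSet C) {r₀ t₀ : ℝ} (ht₀ : t₀ ≤ 1 / 30)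
    (hCsub : ∀ v ∈ C, v ∈ capBalancedSet L ∧ ‖linkEmbed L v‖ ≤ r₀ ∧ ∀ (e : Edge 3 L) (c : Fin 3), |v e c| ≤ t₀)
    (hθ : 0 < ∫ v in C, Ω (linkEmbed L v) ∂orthoTransverse L) {ε : ℝ} (hε : 0 < ε) {ρ : ℝ} (hρ : 0 < ρ) (hρ1 : ρ ≤ 1)
    {M : (Edge 3 L → Fin 3 → ℝ) × ((Edge 3 L → Fin 3 → ℝ) × (Site 3 L → SU2)) → ℝ} (hMm : Measurable M) (hM0 : ∀ p, 0 ≤ M p) {D : ℝ} (hD : 0 ≤ D) {k : ℕ}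
    (hM : ∀ p, M p ≤ D * (β * kinDefect L (orthoTube L 1 p.1) (orthoTube L 1 p.2.1) p.2.2 + 1) ^ k) :
    ∫ p, fpTriple L β Ω (fpWeight L ε) 1 1 p * M p ∂((orthoTransverse L).prod ((orthoTransverse L).prod (gaugeMeasure L))) ≤
      (5 * Real.exp 1 * 2 ^ k * 4 ^ (3 * Fintype.card {x : Site 3 L // ¬x = 0}) * k.factorial * (3 * Fintype.card {x : Site 3 L // ¬x = 0}).factorial * 1 * D *
          (fpZ ε * ((π ^ 2 / 12) ^ Fintype.card {x : Site 3 L // ¬x = 0} * (3 * (L : ℝ)) ^ (3 * Fintype.card {x : Site 3 L // ¬x = 0}) *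
              3 ^ (3 * Fintype.card {x : Site 3 L // ¬x = 0}) * ((Real.sqrt β)⁻¹) ^ (3 * Fintype.card {x : Site 3 L // ¬x = 0})) *
            ((∫ v, Ω (linkEmbed L v) ∂orthoTransverse L) ^ 2 +
              ((5 * Real.sqrt 2) ^ (3 * Fintype.card {x : Site 3 L // ¬x = 0}) + Real.sqrt 2 ^ (3 * Fintype.card {x : Site 3 L // ¬x = 0})) *
                (∫ v, Ω (linkEmbed L v) ∂orthoTransverse L) * ∫ v, Ω (linkEmbed L v) * (Real.sqrt β * ‖linkEmbed L v‖) ^ (3 * Fintype.card {x : Site 3 L // ¬x = 0}) ∂orthoTransverse L)) /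
        (Real.exp (-(β * ((Fintype.card (Edge 3 L) : ℝ) * (2 * ρ + 2 * Real.sqrt 2 * r₀) ^ 2)) -
              β / 2 * (((10 * Real.sqrt (Fintype.card (Plaquette 3 L × Fin 3)) * r₀) ^ 2 + stepActionErr (L := L) t₀ 0) +
                ((10 * Real.sqrt (Fintype.card (Plaquette 3 L × Fin 3)) * r₀) ^ 2 + stepActionErr (L := L) t₀ 0))) *
          (fpZ ε * (ρ ^ 3 / 10) ^ Fintype.card {x : Site 3 L // ¬x = 0} * (∫ v in C, Ω (linkEmbed L v) ∂orthoTransverse L) ^ 2))) *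
      ∫ p, fpTriple L β Ω (fpWeight L ε) 1 1 p ∂((orthoTransverse L).prod ((orthoTransverse L).prod (gaugeMeasure L))) := by
  haveI := isFiniteMeasure_orthoTransverse L
  haveI : SecondCountableTopology SU2 := secondCountableTopology_su2
  set n : ℕ := Fintype.card {x : Site 3 L // ¬x = 0} with hn
  set μP : Measure ((Edge 3 L → Fin 3 → ℝ) × ((Edge 3 L → Fin 3 → ℝ) × (Site 3 L → SU2))) := (orthoTransverse L).prod ((orthoTransverse L).prod (gaugeMeasure L)) with hμP
  haveI : IsFiniteMeasure μP := by rw [hμP]; infer_instance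
  set K1 : ℝ := transferKernel su2Rep ((L : ℝ) ^ 3 * β) (1 : GaugeConfig 3 1 SU2) 1 with hK1
  have hK1p : 0 < K1 := transferKernel_pos _ _ _ _
  have hle : Measurable (linkEmbed L) := measurable_linkEmbed L
  have hfw : Measurable (fpWeight L ε) := measurable_fpWeight L ε
  have hCΩ0 : 0 ≤ CΩ := (abs_nonneg _).trans (hCΩ 0)
  -- the weight `F`, the kernel ratio `σ`, the level `N`
  set F : (Edge 3 L → Fin 3 → ℝ) × ((Edge 3 L → Fin 3 → ℝ) × (Site 3 L → SU2)) → ℝ := fun p => Ω (linkEmbed L p.1) * (fpWeight L ε p.2.2 * Ω (linkEmbed L p.2.1)) with hF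
  set σ : (Edge 3 L → Fin 3 → ℝ) × ((Edge 3 L → Fin 3 → ℝ) × (Site 3 L → SU2)) → ℝ := fun p => fpTriple L β (fun _ => (1 : ℝ)) (fun _ => (1 : ℝ)) 1 1 p / K1 with hσ
  have hσ_eq : ∀ p, σ p = transferKernel su2Rep β (orthoTube L 1 p.1) (gaugeTransform p.2.2 (orthoTube L 1 p.2.1)) / K1 := fun p => by
    rw [hσ]; dsimp only; unfold fpTriple; ring
  have hρ_eq : ∀ p, fpTriple L β Ω (fpWeight L ε) 1 1 p = K1 * (F p * σ p) := fun p => by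
    rw [hσ_eq, hF]; dsimp only; unfold fpTriple; field_simp
  have hFm : Measurable F := by
    have a1 : Measurable fun p : (Edge 3 L → Fin 3 → ℝ) × ((Edge 3 L → Fin 3 → ℝ) × (Site 3 L → SU2)) => Ω (linkEmbed L p.1) := hΩm.comp (hle.comp measurable_fst)
    have a2 : Measurable fun p : (Edge 3 L → Fin 3 → ℝ) × ((Edge 3 L → Fin 3 → ℝ) × (Site 3 L → SU2)) => fpWeight L ε p.2.2 := hfw.comp (measurable_snd.comp measurable_snd)
    have a3 : Measurable fun p : (Edge 3 L → Fin 3 → ℝ) × ((Edge 3 L → Fin 3 → ℝ) × (Site 3 L → SU2)) => Ω (linkEmbed L p.2.1) :=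
      hΩm.comp (hle.comp (measurable_fst.comp measurable_snd))
    exact a1.mul (a2.mul a3)
  have hF0 : ∀ p, 0 ≤ F p := fun p => mul_nonneg (hΩ0 _) (mul_nonneg (fpWeight_mem_Icc L ε _).1 (hΩ0 _))
  have hFb : ∀ p, F p ≤ CΩ * CΩ := fun p => by
    calc F p = Ω (linkEmbed L p.1) * (fpWeight L ε p.2.2 * Ω (linkEmbed L p.2.1)) := rfl
      _ ≤ CΩ * (1 * CΩ) := mul_le_mul ((le_abs_self _).trans (hCΩ _)) (mul_le_mul (fpWeight_mem_Icc L ε _).2 ((le_abs_self _).trans (hCΩ _)) (hΩ0 _) zero_le_one)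
            (mul_nonneg (fpWeight_mem_Icc L ε _).1 (hΩ0 _)) hCΩ0
      _ = CΩ * CΩ := by ring
  have hσm : Measurable σ := (measurable_fpTriple β measurable_const measurable_const 1 1).div_const _
  have hσ0 : ∀ p, 0 ≤ σ p := fun p => by rw [hσ_eq]; exact div_nonneg (transferKernel_pos _ _ _ _).le hK1p.le
  have hNm' := (continuous_kinDefect_joint (L := L)).measurable.comp
    (((measurable_orthoTube_right (L := L) 1).comp measurable_fst).prodMk
      (((measurable_orthoTube_right (L := L) 1).comp (measurable_fst.comp measurable_snd)).prodMk (measurable_snd.comp measurable_snd)))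
  have hNm : Measurable fun p : (Edge 3 L → Fin 3 → ℝ) × ((Edge 3 L → Fin 3 → ℝ) × (Site 3 L → SU2)) => β * kinDefect L (orthoTube L 1 p.1) (orthoTube L 1 p.2.1) p.2.2 :=
    hNm'.const_mul β
  have hN0 : ∀ p : (Edge 3 L → Fin 3 → ℝ) × ((Edge 3 L → Fin 3 → ℝ) × (Site 3 L → SU2)), 0 ≤ β * kinDefect L (orthoTube L 1 p.1) (orthoTube L 1 p.2.1) p.2.2 := fun p =>
    mul_nonneg hβ.le (kinDefect_nonneg _ _ _)
  have hσup : ∀ p, σ p ≤ 1 * Real.exp (-(β * kinDefect L (orthoTube L 1 p.1) (orthoTube L 1 p.2.1) p.2.2)) := fun p => by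
    rw [hσ_eq, one_mul]; exact kernelRatio_le hβ.le p.1 p.2.1 p.2.2
  -- volume growth (closed form)
  set V : ℝ := fpZ ε * ((π ^ 2 / 12) ^ n * (3 * (L : ℝ)) ^ (3 * n) * 3 ^ (3 * n) * ((Real.sqrt β)⁻¹) ^ (3 * n)) *
      ((∫ v, Ω (linkEmbed L v) ∂orthoTransverse L) ^ 2 + ((5 * Real.sqrt 2) ^ (3 * n) + Real.sqrt 2 ^ (3 * n)) *
        (∫ v, Ω (linkEmbed L v) ∂orthoTransverse L) * ∫ v, Ω (linkEmbed L v) * (Real.sqrt β * ‖linkEmbed L v‖) ^ (3 * n) ∂orthoTransverse L) with hV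
  have hVgrowth : ∀ t : ℝ, 0 ≤ t → ∫ p in {p | β * kinDefect L (orthoTube L 1 p.1) (orthoTube L 1 p.2.1) p.2.2 ≤ t}, F p ∂μP ≤ V * (t + 1) ^ (3 * n) := fun t ht => by
    rw [hμP, hV, hF]; exact profile_volume_growth (L := L) hβ hΩm hCΩ hΩ0 hΩt ε ht
  -- the floor: `∫ Fσ ≥ c₁ · fpZ (ρ³/10)^n θ²`
  set D₀ : ℝ := (Fintype.card (Edge 3 L) : ℝ) * (2 * ρ + 2 * Real.sqrt 2 * r₀) ^ 2 with hD₀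
  set c₁ : ℝ := Real.exp (-(β * D₀) - β / 2 * (((10 * Real.sqrt (Fintype.card (Plaquette 3 L × Fin 3)) * r₀) ^ 2 + stepActionErr (L := L) t₀ 0) +
      ((10 * Real.sqrt (Fintype.card (Plaquette 3 L × Fin 3)) * r₀) ^ 2 + stepActionErr (L := L) t₀ 0))) with hc₁
  have hc₁p : 0 < c₁ := Real.exp_pos _
  set A : Set ((Edge 3 L → Fin 3 → ℝ) × ((Edge 3 L → Fin 3 → ℝ) × (Site 3 L → SU2))) :=
    {p | kinDefect L (orthoTube L 1 p.1) (orthoTube L 1 p.2.1) p.2.2 ≤ D₀} ∩ C ×ˢ (C ×ˢ (Set.univ : Set (Site 3 L → SU2))) with hA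
  have hAm : MeasurableSet A := (measurableSet_tubeKinLevelSet (L := L) D₀).inter (hC.prod (hC.prod MeasurableSet.univ))
  have hΩt' : ∀ v : Edge 3 L → Fin 3 → ℝ, Ω (linkEmbed L v) ≠ 0 → v ∈ capBalancedSet L := fun v hv => (hΩt v hv).1
  have hfloorF : fpZ ε * (ρ ^ 3 / 10) ^ n * (∫ v in C, Ω (linkEmbed L v) ∂orthoTransverse L) ^ 2 ≤ ∫ p in A, F p ∂μP := by
    rw [hμP, hA, hF]; exact setIntegral_profile_kinLevelSet_ge (L := L) hΩm hCΩ hΩ0 hΩt' hC (fun v hv => (hCsub v hv).2.1) ε hρ hρ1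
  have hσA : ∀ p ∈ A, c₁ ≤ σ p := by
    rintro ⟨v, v', g⟩ ⟨hk, hP⟩
    have hvC : v ∈ C := (Set.mem_prod.mp hP).1
    have hv'C : v' ∈ C := (Set.mem_prod.mp (Set.mem_prod.mp hP).2).1
    obtain ⟨hvc, hvr, hvt⟩ := hCsub v hvC
    obtain ⟨hv'c, hv'r, hv't⟩ := hCsub v' hv'C
    have hk' : kinDefect L (orthoTube L 1 v) (orthoTube L 1 v') g ≤ D₀ := hk
    have h := kernelRatio_ge_on_levelSet (L := L) hβ.le hvc hv'c ht₀ hvt hv't hk'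
    rw [hσ_eq]
    refine le_trans ?_ h
    rw [hc₁]
    refine Real.exp_le_exp.mpr ?_
    have hN0' : 0 ≤ 10 * Real.sqrt (Fintype.card (Plaquette 3 L × Fin 3) : ℝ) := by positivity
    have h1 : (10 * Real.sqrt (Fintype.card (Plaquette 3 L × Fin 3)) * ‖linkEmbed L v‖) ^ 2 ≤ (10 * Real.sqrt (Fintype.card (Plaquette 3 L × Fin 3)) * r₀) ^ 2 :=
      pow_le_pow_left₀ (by positivity) (mul_le_mul_of_nonneg_left hvr hN0') 2
    have h2 : (10 * Real.sqrt (Fintype.card (Plaquette 3 L × Fin 3)) * ‖linkEmbed L v'‖) ^ 2 ≤ (10 * Real.sqrt (Fintype.card (Plaquette 3 L × Fin 3)) * r₀) ^ 2 :=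
      pow_le_pow_left₀ (by positivity) (mul_le_mul_of_nonneg_left hv'r hN0') 2
    have hβ2 : 0 ≤ β / 2 := by linarith
    nlinarith [mul_le_mul_of_nonneg_left (add_le_add h1 h2) hβ2]
  -- `∫ Fσ ≥ ∫_A Fσ ≥ c₁ ∫_A F`
  have hFσm : Measurable fun p => F p * σ p := hFm.mul hσm
  have hFσ0 : ∀ p, 0 ≤ F p * σ p := fun p => mul_nonneg (hF0 p) (hσ0 p)
  have hFσb : ∀ p, |F p * σ p| ≤ CΩ * CΩ * 1 := fun p => by
    rw [abs_of_nonneg (hFσ0 p)]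
    refine mul_le_mul (hFb p) ?_ (hσ0 p) (mul_nonneg hCΩ0 hCΩ0)
    calc σ p ≤ 1 * Real.exp (-(β * kinDefect L (orthoTube L 1 p.1) (orthoTube L 1 p.2.1) p.2.2)) := hσup p
      _ ≤ 1 * 1 := mul_le_mul_of_nonneg_left (Real.exp_le_one_iff.mpr (by linarith [hN0 p])) zero_le_one
      _ = 1 := one_mul _
  have hFσi : Integrable (fun p => F p * σ p) μP := integrable_of_measurable_abs_le _ hFσm hFσb
  have hFi : Integrable F μP := integrable_of_measurable_abs_le _ hFm (C := CΩ * CΩ) fun p => by rw [abs_of_nonneg (hF0 p)]; exact hFb p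
  have hden : c₁ * (fpZ ε * (ρ ^ 3 / 10) ^ n * (∫ v in C, Ω (linkEmbed L v) ∂orthoTransverse L) ^ 2) ≤ ∫ p, F p * σ p ∂μP := by
    calc c₁ * (fpZ ε * (ρ ^ 3 / 10) ^ n * (∫ v in C, Ω (linkEmbed L v) ∂orthoTransverse L) ^ 2) ≤ c₁ * ∫ p in A, F p ∂μP :=
          mul_le_mul_of_nonneg_left hfloorF hc₁p.le
      _ = ∫ p in A, c₁ * F p ∂μP := (integral_const_mul _ _).symm
      _ ≤ ∫ p in A, F p * σ p ∂μP := setIntegral_mono_on (hFi.const_mul c₁).integrableOn hFσi.integrableOn hAm fun p hp => by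
          rw [mul_comm]; exact mul_le_mul_of_nonneg_left (hσA p hp) (hF0 p)
      _ ≤ ∫ p, F p * σ p ∂μP := setIntegral_le_integral hFσi (ae_of_all _ hFσ0)
  have hden0 : 0 < c₁ * (fpZ ε * (ρ ^ 3 / 10) ^ n * (∫ v in C, Ω (linkEmbed L v) ∂orthoTransverse L) ^ 2) :=
    mul_pos hc₁p (mul_pos (mul_pos (fpZ_pos hε) (by positivity)) (by positivity))
  -- the weighted moment ratio
  have hv0 : 0 < fpZ ε * (ρ ^ 3 / 10) ^ n * (∫ v in C, Ω (linkEmbed L v) ∂orthoTransverse L) ^ 2 := mul_pos (mul_pos (fpZ_pos hε) (by positivity)) (by positivity)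
  have hmain := moment_ratio_le_weighted μP hFm hF0 hFb hNm hN0 hVgrowth hAm hv0 hfloorF hσm hMm hσ0 zero_le_one hc₁p hD hσup hσA hM0 hM
  -- convert to `fpTriple`-currency (a factor `K1` on both sides)
  have e1 : ∫ p, fpTriple L β Ω (fpWeight L ε) 1 1 p * M p ∂μP = K1 * ∫ p, F p * (σ p * M p) ∂μP := by
    rw [← integral_const_mul]; exact integral_congr_ae (ae_of_all _ fun p => by dsimp only; rw [hρ_eq p]; ring)
  have e2 : ∫ p, fpTriple L β Ω (fpWeight L ε) 1 1 p ∂μP = K1 * ∫ p, F p * σ p ∂μP := by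
    rw [← integral_const_mul]; exact integral_congr_ae (ae_of_all _ fun p => hρ_eq p)
  rw [hμP] at e1 e2 hmain
  rw [e1, e2]
  calc K1 * ∫ p, F p * (σ p * M p) ∂(orthoTransverse L).prod ((orthoTransverse L).prod (gaugeMeasure L))
      ≤ K1 * (5 * Real.exp 1 * 2 ^ k * 4 ^ (3 * n) * k.factorial * (3 * n).factorial * 1 * D * V /
          (c₁ * (fpZ ε * (ρ ^ 3 / 10) ^ n * (∫ v in C, Ω (linkEmbed L v) ∂orthoTransverse L) ^ 2)) *
          ∫ p, F p * σ p ∂(orthoTransverse L).prod ((orthoTransverse L).prod (gaugeMeasure L))) := mul_le_mul_of_nonneg_left hmain hK1p.le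
    _ = _ := by rw [hV, hc₁]; ring

end Summit.QuantumFields.YangMills.Theorems.FemtoTransferGap.RateTube

end
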